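import Summits.ResolutionOfSingularities.ResolutionOfSingularities.Theorems.WildQuotientsSummitReductionStubPairSsCodimThreeCodimTwo
import Literature.AlgebraicGeometry.Resolution.AlterationsSemiStableCodimTwoBlowupFibres
import Literature.AlgebraicGeometry.Resolution.BlowupsProperProofs
import Literature.AlgebraicGeometry.Resolution.AdicQuotient
import HarnessLib

/-!
# `WildQuotients.SummitReduction` (stmt-ResolutionOfSingularities-16324), line `FramePerfect`:
# lemmas for stub hB (`stub_pair_orbitBlowupClaim`) — what happens off the exceptional locus

Route `ResolutionOfSingularities/WildQuotients`, crux `SummitReduction`; helper file of the line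
skeleton `Cruxes/SummitReduction/Lines/FramePerfect.lean` (v7), stub hB = de Jong 1996, 3.4, the
Claim (ii)–(iii) for ONE blowing up `π : X₁ ⟶ X` of the reduced orbit closure `Z = cl(G · x)` of a
codimension-2 singular point of a `G`-semi-stable quasi-split pair, with quasi-splitness upstairs
(de Jong 1997, proof of Prop. 5.11 ¶1). General lemmas, for an arbitrary closed centre `Z ⊆ X`
blown up in its reduced ideal sheaf, in the binder conventions of the line (no Situation 4.23, any
field): over `X ∖ Z` the blow-up is an isomorphism (Stacks 02OS), so there

* the stalk maps of `π` are isomorphisms (`isIso_stalkMap_of_isBlowup_vanishingIdeal_of_notMem`);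
* the quasi-split rendering of the line — completed FIBRE local ring `≅ κ(y)⟦u, v⟧/(uv)`
  compatibly with `κ(y)` — transports from `f` at `π x'` to `π ≫ f` at `x'`
  (`quasiSplitRendering_of_ringEquiv`, pure algebra; `quasiSplitAt_comp_of_isIso_stalkMap`);

and, globally,

* `isSemiStableCurve_comp_of_isBlowup_vanishingIdeal` — **2.21 for `π ≫ f` from its content over
  the exceptional locus** (flatness and nodal geometric fibres at the points over `Z`, geometric
  connectedness of the fibres of `π` over `Z`): the tree's
  `DeJong1996.SemiStablePair.isSemiStableCurve_comp_blowup` (one component `cl{x}`, Situation 4.23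
  over an algebraically closed field) for an arbitrary closed centre and any field (Stacks 02NS,
  02OS, 0377).
-/

-- the problem path `ResolutionOfSingularities/ResolutionOfSingularities` makes the conventional
-- namespace repeat a component, which `linter.dupNamespace` flags
set_option linter.dupNamespace false

noncomputable section

open CategoryTheory CategoryTheory.Limits AlgebraicGeometry TopologicalSpace
open Literature.AlgebraicGeometry.Resolution
open Literature.AlgebraicGeometry
open Scheme.IdealSheafData

namespace Summit.ResolutionOfSingularities.ResolutionOfSingularities.Theorems

/-! ## Off the centre a blow-up in a reduced ideal is a local isomorphism -/

/-- **Stacks 02OS at a point**: a blowing up `π` of `X` in the reduced ideal sheaf of a closed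
subset `Z` induces an isomorphism of stalks `𝒪_{X, π x'} ≅ 𝒪_{X₁, x'}` at every `x'` with
`π x' ∉ Z` (`π` is an isomorphism over `X ∖ Z = X ∖ supp I(Z)`, `IsBlowup.isIso_compl`).
[cite: StacksProject, Tag 02OS] -/
theorem isIso_stalkMap_of_isBlowup_vanishingIdeal_of_notMem {X₁ X : Scheme.{0}} {π : X₁ ⟶ X}
    {Z : Set X} (hZ : IsClosed Z) (hπ : IsBlowup π (vanishingIdeal ⟨Z, hZ⟩)) {x' : X₁}
    (hx' : π.base x' ∉ Z) : IsIso (π.stalkMap x') := by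
  haveI : IsIso (π ∣_ centreCompl (vanishingIdeal ⟨Z, hZ⟩)) := hπ.isIso_compl
  have hmem : π.base x' ∈ centreCompl (vanishingIdeal ⟨Z, hZ⟩) := by
    show π.base x' ∈ ((vanishingIdeal ⟨Z, hZ⟩).support : Set X)ᶜ
    rw [Scheme.IdealSheafData.coe_support_vanishingIdeal]
    exact hx'
  exact isIso_stalkMap_of_isIso_morphismRestrict π _ x' hmem

/-! ## The quasi-split rendering transports along local isomorphisms over `Y` -/

/-- **Transport of the quasi-split rendering along an isomorphism of `A`-algebras** (pure
commutative algebra). For local `A`-algebras `σ : A → B`, `σ₁ : A → B₁` and a ring isomorphism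
`φ : B ≅ B₁` over `A`, an isomorphism `(B/𝔪_A B)^ ≅ κ_A⟦u, v⟧/(uv)` compatible with `κ_A`
(completion along the maximal ideal of `B`) yields the same for `B₁`: `φ` passes to
`B/𝔪_A B ≅ B₁/𝔪_A B₁` (`Ideal.quotientEquiv`), respects the maximal ideals, hence passes to the
adic completions (`adicCompletionCongr`), compatibly with `κ_A` throughout. [folklore] -/
theorem quasiSplitRendering_of_ringEquiv {A B B₁ : Type} [CommRing A] [IsLocalRing A]
    [CommRing B] [IsLocalRing B] [CommRing B₁] [IsLocalRing B₁] (σ : A →+* B) (σ₁ : A →+* B₁)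
    (φ : B ≃+* B₁) (hφ : ∀ a : A, φ (σ a) = σ₁ a)
    (h : ∃ e : AdicCompletion
        ((IsLocalRing.maximalIdeal B).map (Ideal.Quotient.mk ((IsLocalRing.maximalIdeal A).map σ)))
        (B ⧸ (IsLocalRing.maximalIdeal A).map σ) ≃+*
      MvPowerSeries (Fin 2) (A ⧸ IsLocalRing.maximalIdeal A) ⧸
        Ideal.span {(MvPowerSeries.X 0 * MvPowerSeries.X 1 :
          MvPowerSeries (Fin 2) (A ⧸ IsLocalRing.maximalIdeal A))},
      e.toRingHom.comp ((algebraMap (B ⧸ (IsLocalRing.maximalIdeal A).map σ) _).comp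
        (Ideal.quotientMap ((IsLocalRing.maximalIdeal A).map σ) σ Ideal.le_comap_map)) =
      algebraMap (A ⧸ IsLocalRing.maximalIdeal A) _) :
    ∃ e : AdicCompletion
        ((IsLocalRing.maximalIdeal B₁).map (Ideal.Quotient.mk ((IsLocalRing.maximalIdeal A).map σ₁)))
        (B₁ ⧸ (IsLocalRing.maximalIdeal A).map σ₁) ≃+*
      MvPowerSeries (Fin 2) (A ⧸ IsLocalRing.maximalIdeal A) ⧸
        Ideal.span {(MvPowerSeries.X 0 * MvPowerSeries.X 1 :
          MvPowerSeries (Fin 2) (A ⧸ IsLocalRing.maximalIdeal A))},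
      e.toRingHom.comp ((algebraMap (B₁ ⧸ (IsLocalRing.maximalIdeal A).map σ₁) _).comp
        (Ideal.quotientMap ((IsLocalRing.maximalIdeal A).map σ₁) σ₁ Ideal.le_comap_map)) =
      algebraMap (A ⧸ IsLocalRing.maximalIdeal A) _ := by
  obtain ⟨e, he⟩ := h
  have hφσ : φ.toRingHom.comp σ = σ₁ := RingHom.ext hφ
  have hI : (IsLocalRing.maximalIdeal A).map σ₁ =
      ((IsLocalRing.maximalIdeal A).map σ).map (φ : B →+* B₁) := by
    rw [Ideal.map_map, ← hφσ]
    rfl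
  let ψ : B ⧸ (IsLocalRing.maximalIdeal A).map σ ≃+* B₁ ⧸ (IsLocalRing.maximalIdeal A).map σ₁ :=
    Ideal.quotientEquiv _ _ φ hI
  have hψ : ∀ b : B, ψ (Ideal.Quotient.mk _ b) = Ideal.Quotient.mk _ (φ b) := fun b => rfl
  have hJ : ((IsLocalRing.maximalIdeal B).map
      (Ideal.Quotient.mk ((IsLocalRing.maximalIdeal A).map σ))).map ψ.toRingHom =
      (IsLocalRing.maximalIdeal B₁).map (Ideal.Quotient.mk ((IsLocalRing.maximalIdeal A).map σ₁)) := by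
    have hcomp : ψ.toRingHom.comp (Ideal.Quotient.mk _) = (Ideal.Quotient.mk _).comp φ.toRingHom :=
      RingHom.ext fun b => hψ b
    rw [Ideal.map_map, hcomp, ← Ideal.map_map, map_maximalIdeal_of_ringEquiv φ]
  let C := adicCompletionCongr _ _ ψ hJ
  refine ⟨C.symm.trans e, ?_⟩
  refine RingHom.ext fun c => ?_
  obtain ⟨a, rfl⟩ := Ideal.Quotient.mk_surjective c
  have h0 := RingHom.congr_fun he (Ideal.Quotient.mk _ a)
  rw [RingHom.comp_apply, RingHom.comp_apply, Ideal.quotientMap_mk,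
    AdicCompletion.algebraMap_apply, Algebra.algebraMap_self_apply] at h0
  rw [RingHom.comp_apply, RingHom.comp_apply, Ideal.quotientMap_mk,
    AdicCompletion.algebraMap_apply, Algebra.algebraMap_self_apply]
  have hC : C (AdicCompletion.of _ _ (Ideal.Quotient.mk _ (σ a))) =
      AdicCompletion.of _ _ (Ideal.Quotient.mk _ (σ₁ a)) := by
    rw [adicCompletionCongr_of, hψ, hφ]
  change e (C.symm (AdicCompletion.of _ _ (Ideal.Quotient.mk _ (σ₁ a)))) = _
  rw [← hC, RingEquiv.symm_apply_apply]
  exact h0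

/-- **Quasi-splitness is invariant under local isomorphisms over `Y`.** The line renders "`f` is
quasi-split at `x`" (de Jong 1996, 2.22–2.23; de Jong 1997, 5.9) on the completed local ring of
the FIBRE: `(𝒪_{X,x}/𝔪_y 𝒪_{X,x})^ ≅ κ(y)⟦u, v⟧/(uv)` compatibly with `κ(y)`, `y = f x`. If
`π : X₁ → X` induces an isomorphism of stalks `𝒪_{X, π x'} ≅ 𝒪_{X₁, x'}` — an isomorphism of
`𝒪_{Y,y}`-algebras, `(π ≫ f)^#_{x'} = π^#_{x'} ∘ f^#_{π x'}` — then the rendering at `π x'` for `f`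
transports to the rendering at `x'` for `π ≫ f` (`quasiSplitRendering_of_ringEquiv`).
[cite: DeJong1996, 2.22–2.23, pp. 61–62] -/
theorem quasiSplitAt_comp_of_isIso_stalkMap {X₁ X Y : Scheme.{0}} (π : X₁ ⟶ X) (f : X ⟶ Y)
    (x' : X₁) [IsIso (π.stalkMap x')]
    (h : ∃ e : AdicCompletion
        ((IsLocalRing.maximalIdeal (X.presheaf.stalk (π.base x'))).map (Ideal.Quotient.mk
          ((IsLocalRing.maximalIdeal (Y.presheaf.stalk (f.base (π.base x')))).map
            (f.stalkMap (π.base x')).hom)))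
        (X.presheaf.stalk (π.base x') ⧸
          (IsLocalRing.maximalIdeal (Y.presheaf.stalk (f.base (π.base x')))).map
            (f.stalkMap (π.base x')).hom) ≃+*
      MvPowerSeries (Fin 2) (Y.presheaf.stalk (f.base (π.base x')) ⧸
          IsLocalRing.maximalIdeal (Y.presheaf.stalk (f.base (π.base x')))) ⧸
        Ideal.span {(MvPowerSeries.X 0 * MvPowerSeries.X 1 :
          MvPowerSeries (Fin 2) (Y.presheaf.stalk (f.base (π.base x')) ⧸
            IsLocalRing.maximalIdeal (Y.presheaf.stalk (f.base (π.base x')))))},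
      e.toRingHom.comp ((algebraMap (X.presheaf.stalk (π.base x') ⧸
          (IsLocalRing.maximalIdeal (Y.presheaf.stalk (f.base (π.base x')))).map
            (f.stalkMap (π.base x')).hom) _).comp
        (Ideal.quotientMap ((IsLocalRing.maximalIdeal (Y.presheaf.stalk (f.base (π.base x')))).map
            (f.stalkMap (π.base x')).hom)
          (f.stalkMap (π.base x')).hom Ideal.le_comap_map)) =
      algebraMap (Y.presheaf.stalk (f.base (π.base x')) ⧸
        IsLocalRing.maximalIdeal (Y.presheaf.stalk (f.base (π.base x')))) _) :
    ∃ e : AdicCompletion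
        ((IsLocalRing.maximalIdeal (X₁.presheaf.stalk x')).map (Ideal.Quotient.mk
          ((IsLocalRing.maximalIdeal (Y.presheaf.stalk ((π ≫ f).base x'))).map
            ((π ≫ f).stalkMap x').hom)))
        (X₁.presheaf.stalk x' ⧸
          (IsLocalRing.maximalIdeal (Y.presheaf.stalk ((π ≫ f).base x'))).map
            ((π ≫ f).stalkMap x').hom) ≃+*
      MvPowerSeries (Fin 2) (Y.presheaf.stalk ((π ≫ f).base x') ⧸
          IsLocalRing.maximalIdeal (Y.presheaf.stalk ((π ≫ f).base x'))) ⧸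
        Ideal.span {(MvPowerSeries.X 0 * MvPowerSeries.X 1 :
          MvPowerSeries (Fin 2) (Y.presheaf.stalk ((π ≫ f).base x') ⧸
            IsLocalRing.maximalIdeal (Y.presheaf.stalk ((π ≫ f).base x'))))},
      e.toRingHom.comp ((algebraMap (X₁.presheaf.stalk x' ⧸
          (IsLocalRing.maximalIdeal (Y.presheaf.stalk ((π ≫ f).base x'))).map
            ((π ≫ f).stalkMap x').hom) _).comp
        (Ideal.quotientMap ((IsLocalRing.maximalIdeal (Y.presheaf.stalk ((π ≫ f).base x'))).map
            ((π ≫ f).stalkMap x').hom)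
          ((π ≫ f).stalkMap x').hom Ideal.le_comap_map)) =
      algebraMap (Y.presheaf.stalk ((π ≫ f).base x') ⧸
        IsLocalRing.maximalIdeal (Y.presheaf.stalk ((π ≫ f).base x'))) _ := by
  have hφ : ∀ a : Y.presheaf.stalk (f.base (π.base x')),
      (asIso (π.stalkMap x')).commRingCatIsoToRingEquiv ((f.stalkMap (π.base x')).hom a) =
        ((π ≫ f).stalkMap x').hom a := by
    intro a
    change (π.stalkMap x') ((f.stalkMap (π.base x')) a) = ((π ≫ f).stalkMap x') a
    rw [Scheme.Hom.stalkMap_comp]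
    rfl
  exact quasiSplitRendering_of_ringEquiv (f.stalkMap (π.base x')).hom ((π ≫ f).stalkMap x').hom
    (asIso (π.stalkMap x')).commRingCatIsoToRingEquiv hφ h

/-! ## 2.21 for the blown-up curve from its content over the exceptional locus -/

/-- **de Jong 1996, 3.4, Claim (ii) for one blow-up from its exceptional-locus content**, in the
binder conventions of the line (the tree's `DeJong1996.SemiStablePair.isSemiStableCurve_comp_blowup`
for an arbitrary closed centre `Z` of a semi-stable curve `f : X → Y` with integral Noetherian
total space, instead of `cl{x}` in Situation 4.23). Let `π : X₁ → X` be a blowing up in the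
(non-zero) reduced ideal sheaf of `Z`. Suppose that, at the points of `X₁` over `Z`, `π ≫ f` is flat
and the closed points of its geometric fibres are nonsingular points of curves or ordinary double
points, and that the fibres of `π` over the points of `Z` are geometrically connected. Then
`π ≫ f` is a semi-stable curve (2.21): proper (Stacks 02NS), of finite presentation (the base is
locally Noetherian under the flat proper surjection `f`, Stacks 033E), flat and with the fibre
conditions off `π⁻¹(Z)` because `π` is an isomorphism over `X ∖ Z` (Stacks 02OS) — "isomorphism
over an open" being stable under base change to the geometric fibres — and with connected geometric
fibres by Stacks 0377. [cite: DeJong1996, 3.4 Claim (ii), pp. 63–64] -/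
theorem isSemiStableCurve_comp_of_isBlowup_vanishingIdeal {X₁ X Y : Scheme.{0}} [IsIntegral X]
    [IsIntegral Y] [IsLocallyNoetherian X] (f : X ⟶ Y) (hss : IsSemiStableCurve f) {Z : Set X}
    (hZ : IsClosed Z) (hZne : vanishingIdeal ⟨Z, hZ⟩ ≠ ⊥) {π : X₁ ⟶ X}
    (hπ : IsBlowup π (vanishingIdeal ⟨Z, hZ⟩))
    (hflat : ∀ x' : X₁, π.base x' ∈ Z → ((π ≫ f).stalkMap x').hom.Flat)
    (hnodal : ∀ (K : Type) [Field K] [IsAlgClosed K] (s : Spec (.of K) ⟶ Y)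
      (x' : ↥(pullback (π ≫ f) s)), IsClosed ({x'} : Set ↥(pullback (π ≫ f) s)) →
      π.base ((pullback.fst (π ≫ f) s).base x') ∈ Z →
        (IsRegularLocalRing ((pullback (π ≫ f) s).presheaf.stalk x') ∧
            ringKrullDim ((pullback (π ≫ f) s).presheaf.stalk x') = 1) ∨
          IsOrdinaryDoublePoint K x')
    (hconn : ∀ (K : Type) [Field K] [IsAlgClosed K] (c : Spec (.of K) ⟶ X),
      Set.range c.base ⊆ Z → ConnectedSpace ↥(pullback π c)) :
    IsSemiStableCurve (π ≫ f) := by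
  haveI : IsLocallyNoetherian Y := isLocallyNoetherian_base hss
  haveI : Flat f := hss.flat
  haveI : IsProper f := hss.isProper
  have hπm : IsModification π := IsModification.of_isBlowup hπ hZne
  haveI : IsProper π := hπm.isProper
  haveI : IsDominant π := hπm.isDominant
  -- `π` is an isomorphism over `U = X ∖ Z`
  let U : X.Opens := centreCompl (vanishingIdeal ⟨Z, hZ⟩)
  haveI hisoU : IsIso (π ∣_ U) := hπ.isIso_compl
  have hmemU : ∀ {y : X}, y ∉ Z → y ∈ U := fun {y} h => by
    show y ∈ ((vanishingIdeal ⟨Z, hZ⟩).support : Set X)ᶜ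
    rw [Scheme.IdealSheafData.coe_support_vanishingIdeal]
    exact h
  have hlfp : LocallyOfFinitePresentation (π ≫ f) := by
    haveI : LocallyOfFiniteType (π ≫ f) := inferInstance
    infer_instance
  refine ⟨?_, inferInstance, hlfp, fun K _ _ s => ?_, fun K _ _ s xb hxb => ?_⟩
  · -- flat
    refine Flat.of_stalkMap _ fun x' => ?_
    by_cases h : π.base x' ∈ Z
    · exact hflat x' h
    · haveI := isIso_stalkMap_of_isBlowup_vanishingIdeal_of_notMem hZ hπ h
      exact flat_stalkMap_comp_of_isIso_stalkMap π f x'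
  · -- connected geometric fibres (Stacks 0377)
    haveI := hss.connectedSpace_pullback K s
    refine connectedSpace_pullback_comp π f s U fun y hy => ?_
    let κ := (pullback f s).residueField y
    let ι : Spec (.of (AlgebraicClosure κ)) ⟶ Spec κ :=
      Spec.map (CommRingCat.ofHom (algebraMap κ (AlgebraicClosure κ)))
    haveI : Surjective ι := DeJong1996.Stage.surjective_specMap (algebraMap κ (AlgebraicClosure κ))
    haveI := hconn (AlgebraicClosure κ)
      (ι ≫ (pullback f s).fromSpecResidueField y ≫ pullback.fst f s) (by
        rintro _ ⟨t, rfl⟩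
        have ht : ((pullback f s).fromSpecResidueField y).base (ι.base t) ∈
            ({y} : Set ↥(pullback f s)) :=
          (Scheme.range_fromSpecResidueField y).le ⟨ι.base t, rfl⟩
        rw [Set.mem_singleton_iff] at ht
        rw [Scheme.Hom.comp_apply, Scheme.Hom.comp_apply, ht]
        by_contra hZ'
        exact hy (hmemU hZ'))
    exact connectedSpace_pullback_of_surjective_comp π _ ι
  · -- the closed points of the geometric fibres
    by_cases h : π.base ((pullback.fst (π ≫ f) s).base xb) ∈ Z
    · exact hnodal K s xb hxb h
    · let p₁ := pullback.fst f s
      let q := pullback.snd π p₁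
      haveI : IsIso (q ∣_ (p₁ ⁻¹ᵁ U)) := isIso_morphismRestrict_pullback_snd π p₁ U
      let e := pullbackRightPullbackFstIso f s π
      let z := e.inv.base xb
      have hz : (pullback.fst π p₁).base z = (pullback.fst (π ≫ f) s).base xb := by
        change (e.inv ≫ pullback.fst π p₁).base xb = _
        rw [pullbackRightPullbackFstIso_inv_fst]
      have hqz : p₁.base (q.base z) = π.base ((pullback.fst π p₁).base z) := by
        rw [← Scheme.Hom.comp_apply q p₁ z, ← Scheme.Hom.comp_apply (pullback.fst π p₁) π z,
          pullback.condition]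
      have hzU : q.base z ∈ p₁ ⁻¹ᵁ U := by
        change p₁.base (q.base z) ∈ U
        rw [hqz, hz]
        exact hmemU h
      haveI := isIso_stalkMap_of_isIso_morphismRestrict q (p₁ ⁻¹ᵁ U) z hzU
      have hzc : IsClosed ({z} : Set ↥(pullback π p₁)) := by
        have : ({z} : Set ↥(pullback π p₁)) = e.inv.base '' {xb} := by rw [Set.image_singleton]
        rw [this]
        exact e.inv.isClosedEmbedding.isClosedMap _ hxb
      have hqzc : IsClosed ({q.base z} : Set ↥(pullback f s)) := by
        have : ({q.base z} : Set ↥(pullback f s)) = q.base '' {z} := by rw [Set.image_singleton]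
        rw [this]
        exact q.isClosedMap _ hzc
      let ε : (pullback f s).presheaf.stalk (q.base z) ≃+* (pullback (π ≫ f) s).presheaf.stalk xb :=
        (asIso (q.stalkMap z)).commRingCatIsoToRingEquiv.trans
          (asIso (e.inv.stalkMap xb)).commRingCatIsoToRingEquiv
      rcases hss.isRegularLocalRing_or_isOrdinaryDoublePoint K s (q.base z) hqzc with
        ⟨hreg, hdim⟩ | hnode
      · left
        haveI := hreg
        exact ⟨IsRegularLocalRing.of_ringEquiv ε, by rw [← ringKrullDim_eq_of_ringEquiv ε, hdim]⟩
      · exact Or.inr (hnode.of_ringEquiv ε)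

end Summit.ResolutionOfSingularities.ResolutionOfSingularities.Theorems

end
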